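import Summits.QuantumFields.YangMills.Theorems.BalabanUVNodesN07AveragingLocalMatrixModel
import HarnessLib

/-!
# BalabanUVNodes ∕ N07 — THE PER-LEVEL LIFTS OF (45) FROM CENTRAL DESCENDANTS: the right inverse `hH` of `Node00.MultiScaleFibreChart(Local)` ∕ `…N07MultiScaleLiftsRightInverse`
# assembled from ONE-STEP CENTRAL RESPONSES down the block towers, under the support-localised guard and a chain-free tower family — so that on the chart road
# only the per-bond surjectivity of the linearised (0.4) average in its private coordinate `β(c)` stays displayed

Cell `pub-ymgap`, width seat `pub-ymgap-dag-n07-w2` generation 2 (HUMAN RULING D-0149; DAG node N07 = [15] = [Balaban1985Variational]; W-SEAT START LIST §n07 S2, successor piece: the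
LIFTS `hlift` of n07-w2 g0's `Thm/BalabanUVNodesN07MultiScaleLiftsRightInverse` (its S2B-ROADMAP), here by the CENTRAL-BOND mechanism of the tree's `BlockAveragingHaarAC` (FACT (A): the
central crossing bond `β(c)` of a coarse bond `c` is read by the (0.4) average at `c` ONLY) instead of far-face fields).  `--kind proof --supports stmt-QuantumFields-20542 --as helper` (K1⁷;
count-neutral; theorems only).  CONSUMED BY NAME, nothing modified: `BlockAveragingHaarAC` (`centralBond`, `eq_of_mem_walk_loopWord_of_eq_centralBond`, `eq_of_mem_walk_line_of_eq_centralBond`),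
`AveragingRT.blockOf_lineSite`, 35a (`expChart`, `expChart_zero`, `hasDerivAt_coe_expChart_along`, `hasDerivAt_ray`), 35b-i (`avgM`, `corrM`, `loopM`, `axialM`, `coeField`, `coe_avgFun_of_small`,
`norm_loopM_coeField_sub_one_lt_one`), n07-w2 g0 (`hasDerivAt_ray_of_differentiableAt`), this seat's files 1–2 (`contDiffAt_avgM_apply`, `eventually_small_comp_of_small_of_local`,
`contDiffAt_coe_avgFamily_expChart_of_small_on_closedBelow`, `exists_velocity_preimage_of_levelLifts_of_small_on_closedBelow`, `isFibreChartNear_msChart_of_levelLifts_of_small_on_closedBelow`,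
`hasDerivAt_wilsonAction4_expChart_of_isCritOnFibre_of_levelLifts_of_small_on_closedBelow`, `holM_congr`, `avgM_congr_of_window`).

WHY.  After files 1–2 the chart road to the multi-scale tangent form (35g′) displays ONE hypothesis: the per-level LIFTS `hlift`.  Print gets (45) from the propagator `G̃`; n07-e's chain-free road
(35h–35j) gets fibre CURVES from a selective corrector at the CENTRAL bonds under a GLOBAL plaquette guard.  THIS FILE supplies `hlift` in the velocity currency from the same central-bond geometry,
LINEARLY and LOCALLY: a perturbation at the central descendant `β^{j}(c)` of a level-`j` bond `c` is seen, level after level, ONLY along the chain `β^{j−i}(c)` (FACT (A), exact at every background —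
§1 in matrices), so its constrained velocities vanish off the chain, in particular at the lower pins of a CHAIN-FREE tower family (35j's `hCF` shape, verbatim); along the chain the velocity is
pushed up by the ONE-STEP CENTRAL RESPONSE `R_c = D(W ↦ avgM W c)(↑Ū^i U)[· δ_{β(c)}]` (§2: the one-bond velocity brick along curves), and the only analytic input is that `R_c` maps the tangent
space at `Ū^i U(β c)` ONTO the tangent space at `Ū^{i+1} U(c)` — the displayed hypothesis `hresp` (at the flat background `R_c = L^{1−d}·Ad`, cf. the route `UnitScaleTilt`'s
`Prop7FibreVelocity.offCentral_ratio_eq`; its discharge from the guard AT `c` is the next file).  §3 is the ascending induction, §4 the superposition over the pins of one level (velocities are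
values of the Fréchet derivative) and the three consumers: (45) `hH`, 35a's `IsFibreChartNear`, the tangent form.

HONEST FRAMING: kernel calculus and combinatorics over the tree's own averaging; no definition; DISPLAYED HYPOTHESES: the guard on the closed-below family `S` ⊇ pins, the chain-free tower
family (`hCF`, 35j's shape), and the one-step central responses `hresp`; nothing of [15] asserted; stub 1 ∕ K0⁷ NOT closed; N07 NOT discharged; counts unmoved (5∕27); one finite T⁴
programme at fixed ε — NOT continuum ∕ ℝ⁴ ∕ OS ∕ mass gap ∕ Clay (R4 closes the conditional rung `BalabanLadder.UV` only).  No `sorry`, no `instance`, no `notation`.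
-/

noncomputable section

open scoped Matrix.Norms.L2Operator Topology
open Filter

namespace Summit.QuantumFields.YangMills.BalabanUVNodes.N07CentralDescendantLifts

open Literature.MathematicalPhysics.QuantumFieldTheory.Balaban1983to89
open Literature.MathematicalPhysics.QuantumFieldTheory.Balaban1983to89.T4Continuum (T4Family walk LStep)
open Literature.MathematicalPhysics.QuantumFieldTheory.Balaban1983to89.B15DeterminingSets
open Literature.MathematicalPhysics.QuantumFieldTheory.Balaban1983to89.T4AdjointCovarianceUnitary (lieSU)
open Literature.MathematicalPhysics.QuantumFieldTheory.Balaban1983to89.BlockAveraging (Small Idx avgFun)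
open Literature.MathematicalPhysics.QuantumFieldTheory.Balaban1983to89.BlockAveragingHaarAC
  (centralBond eq_of_mem_walk_loopWord_of_eq_centralBond eq_of_mem_walk_line_of_eq_centralBond)
open Literature.MathematicalPhysics.QuantumFieldTheory.Balaban1983to89.ExpMeanLog (expMeanLogSU)
open Literature.MathematicalPhysics.QuantumFieldTheory.Balaban1983to89.Node00
open Summit.QuantumFields.YangMills.BalabanUVNodes.N07MultiScaleLiftsRightInverse (hasDerivAt_ray_of_differentiableAt)
open Summit.QuantumFields.YangMills.BalabanUVNodes.N07AveragingLocalSmooth (contDiffAt_avgM_apply eventually_small_comp_of_small_of_local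
  contDiffAt_coe_avgFamily_expChart_of_small_on_closedBelow exists_velocity_preimage_of_levelLifts_of_small_on_closedBelow
  isFibreChartNear_msChart_of_levelLifts_of_small_on_closedBelow hasDerivAt_wilsonAction4_expChart_of_isCritOnFibre_of_levelLifts_of_small_on_closedBelow)
open Summit.QuantumFields.YangMills.BalabanUVNodes.N07AveragingLocalMatrixModel (holM_congr avgM_congr_of_window)

/-! ## §1  FACT (A) in matrices: the central bond `β(c)` is read at level `j+1` by `c` only; locality of the derivative of `avgM` -/

section Central

variable {P : Params} {j : ℕ} {N : ℕ}

/-- The central crossing bond `β(c)` lies in the (0.4) window of `c`. [cite: Balaban1984PropagatorsI, (1.7) p.18 (bookkeeping)] -/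
theorem window_centralBond (hj : j + 1 ≤ P.m + P.K) (c : PBond P (j + 1)) :
    blockOf (centralBond c).src = c.src ∨ blockOf (centralBond c).src = c.tgt :=
  AveragingRT.blockOf_lineSite hj c (t := (P.L - 1) / 2) (by have := P.L_pos; omega)

/-- The loop matrices AT `c″ ≠ c` do not read the coordinate `β(c)`. [cite: Balaban1987RG1, (0.4) p.253] -/
theorem loopM_congr_off_centralBond (hj : j + 1 ≤ P.m + P.K) {W W' : PBond P j → Matrix (Fin N) (Fin N) ℂ} {c c'' : PBond P (j + 1)} (hc : c'' ≠ c)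
    (h : ∀ b : PBond P j, b ≠ centralBond c → W b = W' b) (i : Idx P) : loopM W c'' i = loopM W' c'' i :=
  holM_congr fun s hs => h s.bond fun hsc => hc (eq_of_mem_walk_loopWord_of_eq_centralBond hj c'' c i (s := s) hs hsc).symm

/-- The straight-segment matrix AT `c″ ≠ c` does not read the coordinate `β(c)`. [cite: Balaban1987RG1, (0.4) p.253] -/
theorem axialM_congr_off_centralBond (hj : j + 1 ≤ P.m + P.K) {W W' : PBond P j → Matrix (Fin N) (Fin N) ℂ} {c c'' : PBond P (j + 1)} (hc : c'' ≠ c)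
    (h : ∀ b : PBond P j, b ≠ centralBond c → W b = W' b) : axialM W c'' = axialM W' c'' :=
  holM_congr fun _ hs => h _ fun hsc => hc (eq_of_mem_walk_line_of_eq_centralBond hj c'' c hs hsc).symm

/-- ★ **FACT (A) IN MATRICES**: the one-step extension `avgM · c″` does not read the central coordinate `β(c)` of any other coarse bond `c ≠ c″` (exact, at every field).
[cite: Balaban1987RG1, (0.4) p.253] -/
theorem avgM_congr_off_centralBond (hj : j + 1 ≤ P.m + P.K) {W W' : PBond P j → Matrix (Fin N) (Fin N) ℂ} {c c'' : PBond P (j + 1)} (hc : c'' ≠ c)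
    (h : ∀ b : PBond P j, b ≠ centralBond c → W b = W' b) : avgM W c'' = avgM W' c'' := by
  show corrM W c'' * axialM W c'' = corrM W' c'' * axialM W' c''
  unfold corrM
  rw [funext fun i => loopM_congr_off_centralBond hj hc h i, axialM_congr_off_centralBond hj hc h]

/-- A differentiable map constant along the line `x + s·v` has zero derivative along `v` (vector-valued twin of the ℝ-valued `Beta.WardIdentity.fderiv_apply_eq_zero_of_const_along`). [folklore] -/
theorem fderiv_apply_eq_zero_of_const_along_line {E F : Type*} [NormedAddCommGroup E] [NormedSpace ℝ E] [NormedAddCommGroup F] [NormedSpace ℝ F]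
    {f : E → F} {x v : E} (hf : DifferentiableAt ℝ f x) (h : ∀ s : ℝ, f (x + s • v) = f x) : fderiv ℝ f x v = 0 := by
  have hline : HasDerivAt (fun s : ℝ => x + s • v) v 0 := by
    have h1 := ((hasDerivAt_id (0 : ℝ)).smul_const v).const_add x
    rwa [one_smul] at h1
  have hcomp : HasDerivAt (fun s : ℝ => f (x + s • v)) (fderiv ℝ f x v) 0 :=
    hf.hasFDerivAt.comp_hasDerivAt_of_eq (0 : ℝ) hline (by rw [zero_smul, add_zero])
  have hconst : HasDerivAt (fun s : ℝ => f (x + s • v)) 0 0 := by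
    have e : (fun s : ℝ => f (x + s • v)) = fun _ => f x := funext h
    rw [e]
    exact hasDerivAt_const 0 (f x)
  exact hcomp.unique hconst

/-- The derivative of `avgM · c` kills every direction vanishing on the window of `c`. [cite: Balaban1987RG1, (0.4) p.253; Balaban1985Averaging, p.19 (locality)] -/
theorem fderiv_avgM_apply_eq_zero_of_eq_zero_on_window (hj : j + 1 ≤ P.m + P.K) {W₀ Z : PBond P j → Matrix (Fin N) (Fin N) ℂ} (c : PBond P (j + 1))
    (hpoly : ∀ i : Idx P, ‖loopM W₀ c i - 1‖ < 1) (hZ : ∀ b : PBond P j, (blockOf b.src = c.src ∨ blockOf b.src = c.tgt) → Z b = 0) :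
    fderiv ℝ (fun W : PBond P j → Matrix (Fin N) (Fin N) ℂ => avgM W c) W₀ Z = 0 :=
  fderiv_apply_eq_zero_of_const_along_line ((contDiffAt_avgM_apply (n := 1) c hpoly).differentiableAt one_ne_zero) fun s =>
    avgM_congr_of_window hj c fun b hb => by rw [Pi.add_apply, Pi.smul_apply, hZ b hb, smul_zero, add_zero]

/-- ★ The derivative of `avgM · c″` kills every direction supported at the central coordinate `β(c)` of another coarse bond `c ≠ c″`. [cite: Balaban1987RG1, (0.4) p.253] -/
theorem fderiv_avgM_apply_eq_zero_of_supported_centralBond (hj : j + 1 ≤ P.m + P.K) {W₀ Z : PBond P j → Matrix (Fin N) (Fin N) ℂ} {c c'' : PBond P (j + 1)} (hc : c'' ≠ c)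
    (hpoly : ∀ i : Idx P, ‖loopM W₀ c'' i - 1‖ < 1) (hZ : ∀ b : PBond P j, b ≠ centralBond c → Z b = 0) :
    fderiv ℝ (fun W : PBond P j → Matrix (Fin N) (Fin N) ℂ => avgM W c'') W₀ Z = 0 :=
  fderiv_apply_eq_zero_of_const_along_line ((contDiffAt_avgM_apply (n := 1) c'' hpoly).differentiableAt one_ne_zero) fun s =>
    avgM_congr_off_centralBond hj hc fun b hb => by rw [Pi.add_apply, Pi.smul_apply, hZ b hb, smul_zero, add_zero]

end Central

/-! ## §2  The one-bond VELOCITY brick along a curve (the curve twin of file 1's `C^n` brick) -/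

section Velocity

variable {P : Params} {j : ℕ} {N : ℕ} [NeZero N]

/-- ★★ **ONE COARSE BOND, ALONG A CURVE**: let `Φ : ℝ → SU(N)^{bonds_j}` be a curve of fields whose window coordinates at `c` have velocities `V̇(b)` at `t = 0` and whose loop variables AT `c` lie
inside the guard at `t = 0`.  Then `t ↦ Ū(Φ t)(c)` (read as a matrix) has velocity `D(W ↦ avgM W c)(↑Φ 0)[V̇]` at `t = 0` — for ANY field `V̇` extending the window velocities (the derivative
does not read `V̇` off the window).  Proof: splice with the frozen `Φ 0` off the window; the guard persists (file 1); there the output is `avgM` of the spliced matrix curve; chain rule; §1.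
[cite: Balaban1987RG1, (0.4) p.253; Balaban1985Variational, (44)–(45) p.285] -/
theorem hasDerivAt_coe_avgFun_comp_apply_of_small_of_local (hj : j + 1 ≤ P.m + P.K) {Φ : ℝ → GaugeField P j (SU N)} (c : PBond P (j + 1))
    (hsmall : Small (expMeanLogSU (n := Fin N)) (Φ 0) c) {Vdot : PBond P j → Matrix (Fin N) (Fin N) ℂ}
    (hvel : ∀ b : PBond P j, (blockOf b.src = c.src ∨ blockOf b.src = c.tgt) →
      HasDerivAt (fun t : ℝ => ((Φ t b : SU N) : Matrix (Fin N) (Fin N) ℂ)) (Vdot b) 0) :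
    HasDerivAt (fun t : ℝ => ((avgFun (expMeanLogSU (n := Fin N)) (Φ t) c : SU N) : Matrix (Fin N) (Fin N) ℂ))
      (fderiv ℝ (fun W : PBond P j → Matrix (Fin N) (Fin N) ℂ => avgM W c) (coeField (Φ 0)) Vdot) 0 := by
  classical
  -- the splice and its velocity
  let Ψ : ℝ → GaugeField P j (SU N) := fun t b =>
    if blockOf b.src = c.src ∨ blockOf b.src = c.tgt then Φ t b else Φ 0 b
  have hΨ0 : Ψ 0 = Φ 0 := by
    funext b
    show (if blockOf b.src = c.src ∨ blockOf b.src = c.tgt then Φ 0 b else Φ 0 b) = Φ 0 b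
    split_ifs <;> rfl
  let Vdot' : PBond P j → Matrix (Fin N) (Fin N) ℂ := fun b =>
    if blockOf b.src = c.src ∨ blockOf b.src = c.tgt then Vdot b else 0
  have hΨvel : HasDerivAt (fun t : ℝ => coeField (Ψ t)) Vdot' 0 := by
    refine hasDerivAt_pi.2 fun b => ?_
    by_cases hb : blockOf b.src = c.src ∨ blockOf b.src = c.tgt
    · have e : (fun t : ℝ => coeField (Ψ t) b) = fun t => ((Φ t b : SU N) : Matrix (Fin N) (Fin N) ℂ) :=
        funext fun t => congrArg (fun g : SU N => (g : Matrix (Fin N) (Fin N) ℂ)) (if_pos hb)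
      have e' : Vdot' b = Vdot b := if_pos hb
      rw [e, e']
      exact hvel b hb
    · have e : (fun t : ℝ => coeField (Ψ t) b) = fun _ => ((Φ 0 b : SU N) : Matrix (Fin N) (Fin N) ℂ) :=
        funext fun t => congrArg (fun g : SU N => (g : Matrix (Fin N) (Fin N) ℂ)) (if_neg hb)
      have e' : Vdot' b = 0 := if_neg hb
      rw [e, e']
      exact hasDerivAt_const 0 _
  -- the guard persists along the splice
  have hguard : ∀ᶠ t in 𝓝 (0 : ℝ), Small (expMeanLogSU (n := Fin N)) (Ψ t) c := by
    refine eventually_small_comp_of_small_of_local hj (Φ := Ψ) c (by rw [hΨ0]; exact hsmall) fun b hb => ?_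
    have e : (fun t : ℝ => ((Ψ t b : SU N) : Matrix (Fin N) (Fin N) ℂ)) = fun t => ((Φ t b : SU N) : Matrix (Fin N) (Fin N) ℂ) :=
      funext fun t => congrArg (fun g : SU N => (g : Matrix (Fin N) (Fin N) ℂ)) (if_pos hb)
    rw [e]
    exact (hvel b hb).continuousAt
  have heq : (fun t : ℝ => ((avgFun (expMeanLogSU (n := Fin N)) (Φ t) c : SU N) : Matrix (Fin N) (Fin N) ℂ)) =ᶠ[𝓝 (0 : ℝ)]
      fun t => avgM (coeField (Ψ t)) c :=
    hguard.mono fun t ht => by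
      show ((avgFun (expMeanLogSU (n := Fin N)) (Φ t) c : SU N) : Matrix (Fin N) (Fin N) ℂ) = avgM (coeField (Ψ t)) c
      rw [BlockAveraging.avgFun_local _ hj (Φ t) (Ψ t) c fun b hb => (if_pos hb).symm]
      exact coe_avgFun_of_small _ c ht
  -- chain rule on the matrix model, then §1's locality of the derivative
  have hpoly : ∀ i : Idx P, ‖loopM (coeField (Φ 0)) c i - 1‖ < 1 := fun i => norm_loopM_coeField_sub_one_lt_one _ c hsmall i
  have hout : HasFDerivAt (fun W : PBond P j → Matrix (Fin N) (Fin N) ℂ => avgM W c)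
      (fderiv ℝ (fun W : PBond P j → Matrix (Fin N) (Fin N) ℂ => avgM W c) (coeField (Φ 0))) (coeField (Ψ 0)) := by
    rw [hΨ0]
    exact ((contDiffAt_avgM_apply (n := 1) c hpoly).differentiableAt one_ne_zero).hasFDerivAt
  have hcomp := hout.comp_hasDerivAt_of_eq (0 : ℝ) hΨvel rfl
  have hD : fderiv ℝ (fun W : PBond P j → Matrix (Fin N) (Fin N) ℂ => avgM W c) (coeField (Φ 0)) Vdot' =
      fderiv ℝ (fun W : PBond P j → Matrix (Fin N) (Fin N) ℂ => avgM W c) (coeField (Φ 0)) Vdot := by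
    have hz := fderiv_avgM_apply_eq_zero_of_eq_zero_on_window hj c hpoly (Z := Vdot - Vdot') fun b hb => by
      show Vdot b - Vdot' b = 0
      rw [show Vdot' b = Vdot b from if_pos hb, sub_self]
    rw [map_sub, sub_eq_zero] at hz
    exact hz.symm
  rw [hD] at hcomp
  exact hcomp.congr_of_eventuallyEq heq

end Velocity

/-! ## §3  At NODE 00's objects: the ascending induction — a single target velocity from its central descendants -/

section Single

variable {F : T4Family} {N : ℕ} [NeZero N] {K k : ℕ} {U : GaugeField (F.P K) 0 (SU N)}

/-- ★★ **A SINGLE TARGET VELOCITY FROM THE CENTRAL DESCENDANTS.**  Under the guard on a closed-below family `S` (standing range) and the one-step central responses `hresp` on `S`, for every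
level `i ≤ k`, every tower family `T` closed under `β` below `i`, every `b ∈ S_i ∩ T_i` and every `Y ∈ 𝔰𝔲(N)` there is a direction `X` whose constrained-output velocities along `t ↦ U·exp(tX)` are:
`Ū^i U(b)·Y` at `(i, b)`; ZERO at every other `b′ ∈ S_i`; ZERO at every `b′ ∈ S_{i′} ∖ T_{i′}`, `i′ < i` (the perturbation lives on the chain of central descendants of `b`, which `T` contains).
Induction on `i`: at `0` take `X = Y·δ_b`; at `i+1` choose by `hresp` the velocity at `β(c)` one level down, lift it by the hypothesis, and push it up by §2 (at `c`) ∕ kill it by §1 (at `c″ ≠ c`).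
[cite: Balaban1985Variational, (45) p.285, (83) p.290; Balaban1987RG1, (0.4) p.253] -/
theorem exists_single_lift_of_centralResponses (hk : k ≤ (F.P K).m + (F.P K).K)
    (S : (i : ℕ) → Set (PBond (F.P K) i))
    (hS : ∀ (i : ℕ) (c : PBond (F.P K) (i + 1)), i + 1 ≤ k → c ∈ S (i + 1) → ∀ b : PBond (F.P K) i, (blockOf b.src = c.src ∨ blockOf b.src = c.tgt) → b ∈ S i)
    (hg : ∀ (i : ℕ) (c : PBond (F.P K) (i + 1)), i + 1 ≤ k → c ∈ S (i + 1) → Small (expMeanLogSU (n := Fin N)) (avgFamily (avOfRecord F N K) U i) c)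
    (hresp : ∀ (i : ℕ) (c : PBond (F.P K) (i + 1)), i + 1 ≤ k → c ∈ S (i + 1) → ∀ Y' : lieSU (Fin N), ∃ Y : lieSU (Fin N),
      fderiv ℝ (fun W : PBond (F.P K) i → Matrix (Fin N) (Fin N) ℂ => avgM W c) (coeField (avgFamily (avOfRecord F N K) U i))
          (Pi.single (centralBond c) (((avgFamily (avOfRecord F N K) U i (centralBond c) : SU N) : Matrix (Fin N) (Fin N) ℂ) * (Y : Matrix (Fin N) (Fin N) ℂ))) =
        ((avgFamily (avOfRecord F N K) U (i + 1) c : SU N) : Matrix (Fin N) (Fin N) ℂ) * (Y' : Matrix (Fin N) (Fin N) ℂ)) :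
    ∀ i, i ≤ k → ∀ T : (i' : ℕ) → Set (PBond (F.P K) i'),
      (∀ (i' : ℕ) (c : PBond (F.P K) (i' + 1)), i' < i → c ∈ T (i' + 1) → centralBond c ∈ T i') →
      ∀ b ∈ S i, b ∈ T i → ∀ Y : lieSU (Fin N), ∃ X : PBond (F.P K) 0 → lieSU (Fin N),
        HasDerivAt (fun t : ℝ => ((avgFamily (avOfRecord F N K) (expChart U (t • X)) i b : SU N) : Matrix (Fin N) (Fin N) ℂ))
          (((avgFamily (avOfRecord F N K) U i b : SU N) : Matrix (Fin N) (Fin N) ℂ) * (Y : Matrix (Fin N) (Fin N) ℂ)) 0 ∧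
        (∀ b' ∈ S i, b' ≠ b →
          HasDerivAt (fun t : ℝ => ((avgFamily (avOfRecord F N K) (expChart U (t • X)) i b' : SU N) : Matrix (Fin N) (Fin N) ℂ)) 0 0) ∧
        (∀ i', i' < i → ∀ b' ∈ S i', b' ∉ T i' →
          HasDerivAt (fun t : ℝ => ((avgFamily (avOfRecord F N K) (expChart U (t • X)) i' b' : SU N) : Matrix (Fin N) (Fin N) ℂ)) 0 0)
  | 0, _, T, _, b, _, _, Y => by
    classical
    refine ⟨Pi.single b Y, ?_, fun b' _ hb' => ?_, fun i' hi' => absurd hi' (Nat.not_lt_zero i')⟩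
    · have h := hasDerivAt_coe_expChart_along (U := U) (c := fun t : ℝ => t • Pi.single b Y) (hasDerivAt_ray _) (zero_smul ℝ _) b
      rw [Pi.single_eq_same] at h
      exact h
    · have h := hasDerivAt_coe_expChart_along (U := U) (c := fun t : ℝ => t • Pi.single b Y) (hasDerivAt_ray _) (zero_smul ℝ _) b'
      rw [Pi.single_eq_of_ne hb', ZeroMemClass.coe_zero, mul_zero] at h
      exact h
  | i + 1, hi, T, hT, c, hc, hcT, Y' => by
    classical
    obtain ⟨Y, hY⟩ := hresp i c hi hc Y'
    have hβS : centralBond c ∈ S i := hS i c hi hc _ (window_centralBond (hi.trans hk) c)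
    have hβT : centralBond c ∈ T i := hT i c (Nat.lt_succ_self i) hcT
    obtain ⟨X, h1, h2, h3⟩ := exists_single_lift_of_centralResponses hk S hS hg hresp i (Nat.le_of_succ_le hi) T
      (fun i' c' hi' hc' => hT i' c' (hi'.trans (Nat.lt_succ_self i)) hc') (centralBond c) hβS hβT Y
    -- the level-`i` velocity field on the window of any `c″ ∈ S (i+1)`: `v` at `β(c)`, `0` elsewhere
    set v : Matrix (Fin N) (Fin N) ℂ := ((avgFamily (avOfRecord F N K) U i (centralBond c) : SU N) : Matrix (Fin N) (Fin N) ℂ) * (Y : Matrix (Fin N) (Fin N) ℂ) with hv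
    have hwin : ∀ c'' : PBond (F.P K) (i + 1), c'' ∈ S (i + 1) → ∀ b' : PBond (F.P K) i, (blockOf b'.src = c''.src ∨ blockOf b'.src = c''.tgt) →
        HasDerivAt (fun t : ℝ => ((avgFamily (avOfRecord F N K) (expChart U (t • X)) i b' : SU N) : Matrix (Fin N) (Fin N) ℂ))
          ((Pi.single (centralBond c) v : PBond (F.P K) i → Matrix (Fin N) (Fin N) ℂ) b') 0 := by
      intro c'' hc'' b' hb'
      by_cases hb : b' = centralBond c
      · subst hb
        rw [Pi.single_eq_same]
        exact h1
      · rw [Pi.single_eq_of_ne hb]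
        exact h2 b' (hS i c'' hi hc'' b' hb') hb
    -- §2's brick at the curve `t ↦ Ū^i(U·exp(tX))`
    have hbrick : ∀ c'' : PBond (F.P K) (i + 1), c'' ∈ S (i + 1) →
        HasDerivAt (fun t : ℝ => ((avgFamily (avOfRecord F N K) (expChart U (t • X)) (i + 1) c'' : SU N) : Matrix (Fin N) (Fin N) ℂ))
          (fderiv ℝ (fun W : PBond (F.P K) i → Matrix (Fin N) (Fin N) ℂ => avgM W c'') (coeField (avgFamily (avOfRecord F N K) U i))
            (Pi.single (centralBond c) v)) 0 := by
      intro c'' hc''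
      have h0 : Small (expMeanLogSU (n := Fin N))
          ((fun t : ℝ => avgFamily (avOfRecord F N K) (expChart U (t • X)) i) 0) c'' := by
        show Small (expMeanLogSU (n := Fin N)) (avgFamily (avOfRecord F N K) (expChart U ((0 : ℝ) • X)) i) c''
        rw [zero_smul, expChart_zero]
        exact hg i c'' hi hc''
      have h := hasDerivAt_coe_avgFun_comp_apply_of_small_of_local (hi.trans hk)
        (Φ := fun t : ℝ => avgFamily (avOfRecord F N K) (expChart U (t • X)) i) c'' h0 (hwin c'' hc'')
      simp only [zero_smul, expChart_zero] at h
      exact h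
    refine ⟨X, ?_, fun c'' hc'' hne => ?_, fun i' hi' b' hb' hbT => ?_⟩
    · have h := hbrick c hc
      rw [hY] at h
      exact h
    · have h := hbrick c'' hc''
      rw [fderiv_avgM_apply_eq_zero_of_supported_centralBond (hi.trans hk) hne
        (fun idx => norm_loopM_coeField_sub_one_lt_one _ c'' (hg i c'' hi hc'') idx) (fun b hb => Pi.single_eq_of_ne hb _)] at h
      exact h
    · rcases Nat.lt_succ_iff_lt_or_eq.1 hi' with hlt | rfl
      · exact h3 i' hlt b' hb' hbT
      · exact h2 b' hb' fun hb => hbT (hb ▸ hβT)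

end Single

/-! ## §4  Superposition over the pins of one level (velocities are values of the Fréchet derivative), `hlift`, and the three consumers -/

section Assembly

variable {F : T4Family} {N : ℕ} [NeZero N] {K k : ℕ} {𝔹 : DetSet (F.P K)} {W : MSField (F.P K) (SU N)} {U : GaugeField (F.P K) 0 (SU N)}

/-- ★★★ **THE PER-LEVEL LIFTS `hlift` FROM ONE-STEP CENTRAL RESPONSES.**  `𝐁` with constrained bonds in a closed-below guarded family `S` (standing range `k`), `U` in the fibre of `W`, a CHAIN-FREE
tower family at every level `ℓ ≤ k` (35j's `hCF`: the pins of level `ℓ` sit in `T_ℓ`, `T` is closed under `β`, and `T_i` misses the pins of every level `i < ℓ`), and the one-step central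
responses `hresp` on `S`.  Then for every level `j ≤ k` and every target family `σ` on the level-`j` bonds there is a direction `X` with constrained velocities `W_j(c)·σ(c)` at the pins of
level `j` and `0` at the pins of every level `i < j` — VERBATIM the hypothesis `hlift` of `…N07MultiScaleLiftsRightInverse.exists_velocity_preimage_of_levelLifts` (sum over the pins of §3's
single lifts; the velocity at a guarded bond is the value of the Fréchet derivative, additive in the direction). [cite: Balaban1985Variational, (45) p.285, (83) p.290; Balaban1984PropagatorsII, p.228] -/
theorem levelLifts_of_centralResponses (hk : k ≤ (F.P K).m + (F.P K).K) (hU : AgreeOn 𝔹 (avgFamily (avOfRecord F N K) U) W)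
    (S : (i : ℕ) → Set (PBond (F.P K) i))
    (hS : ∀ (i : ℕ) (c : PBond (F.P K) (i + 1)), i + 1 ≤ k → c ∈ S (i + 1) → ∀ b : PBond (F.P K) i, (blockOf b.src = c.src ∨ blockOf b.src = c.tgt) → b ∈ S i)
    (hg : ∀ (i : ℕ) (c : PBond (F.P K) (i + 1)), i + 1 ≤ k → c ∈ S (i + 1) → Small (expMeanLogSU (n := Fin N)) (avgFamily (avOfRecord F N K) U i) c)
    (h𝔹S : ∀ j, j ≤ k → bondsOf (𝔹 j) ⊆ S j)
    (hCF : ∀ ℓ, ℓ ≤ k → ∃ T : (i : ℕ) → Set (PBond (F.P K) i), bondsOf (𝔹 ℓ) ⊆ T ℓ ∧ (∀ i, i < ℓ → ∀ c : PBond (F.P K) (i + 1), c ∈ T (i + 1) → centralBond c ∈ T i) ∧ ∀ j, j < ℓ → Disjoint (T j) (bondsOf (𝔹 j)))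
    (hresp : ∀ (i : ℕ) (c : PBond (F.P K) (i + 1)), i + 1 ≤ k → c ∈ S (i + 1) → ∀ Y' : lieSU (Fin N), ∃ Y : lieSU (Fin N),
      fderiv ℝ (fun W : PBond (F.P K) i → Matrix (Fin N) (Fin N) ℂ => avgM W c) (coeField (avgFamily (avOfRecord F N K) U i))
          (Pi.single (centralBond c) (((avgFamily (avOfRecord F N K) U i (centralBond c) : SU N) : Matrix (Fin N) (Fin N) ℂ) * (Y : Matrix (Fin N) (Fin N) ℂ))) =
        ((avgFamily (avOfRecord F N K) U (i + 1) c : SU N) : Matrix (Fin N) (Fin N) ℂ) * (Y' : Matrix (Fin N) (Fin N) ℂ)) :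
    ∀ j, j ≤ k → ∀ σ : PBond (F.P K) j → lieSU (Fin N), ∃ X : PBond (F.P K) 0 → lieSU (Fin N),
      (∀ c ∈ bondsOf (𝔹 j), HasDerivAt (fun t : ℝ => ((avgFamily (avOfRecord F N K) (expChart U (t • X)) j c : SU N) : Matrix (Fin N) (Fin N) ℂ))
        (((W j c : SU N) : Matrix (Fin N) (Fin N) ℂ) * ((σ c : lieSU (Fin N)) : Matrix (Fin N) (Fin N) ℂ)) 0) ∧
      (∀ i, i < j → ∀ c ∈ bondsOf (𝔹 i), HasDerivAt (fun t : ℝ => ((avgFamily (avOfRecord F N K) (expChart U (t • X)) i c : SU N) : Matrix (Fin N) (Fin N) ℂ)) 0 0) := by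
  classical
  intro j hj σ
  obtain ⟨T, hΛT, hT, hdisj⟩ := hCF j hj
  -- one direction per pin of level `j`
  have hone : ∀ c : PBond (F.P K) j, c ∈ bondsOf (𝔹 j) → ∃ X : PBond (F.P K) 0 → lieSU (Fin N),
      HasDerivAt (fun t : ℝ => ((avgFamily (avOfRecord F N K) (expChart U (t • X)) j c : SU N) : Matrix (Fin N) (Fin N) ℂ))
        (((avgFamily (avOfRecord F N K) U j c : SU N) : Matrix (Fin N) (Fin N) ℂ) * ((σ c : lieSU (Fin N)) : Matrix (Fin N) (Fin N) ℂ)) 0 ∧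
      (∀ b' ∈ S j, b' ≠ c →
        HasDerivAt (fun t : ℝ => ((avgFamily (avOfRecord F N K) (expChart U (t • X)) j b' : SU N) : Matrix (Fin N) (Fin N) ℂ)) 0 0) ∧
      (∀ i', i' < j → ∀ b' ∈ S i', b' ∉ T i' →
        HasDerivAt (fun t : ℝ => ((avgFamily (avOfRecord F N K) (expChart U (t • X)) i' b' : SU N) : Matrix (Fin N) (Fin N) ℂ)) 0 0) :=
    fun c hc => exists_single_lift_of_centralResponses hk S hS hg hresp j hj T (fun i' c' hi' hc' => hT i' hi' c' hc') c (h𝔹S j hj hc) (hΛT hc) (σ c)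
  choose! Xc hXc using hone
  -- every constrained output at a guarded bond is differentiable at `X = 0`; its ray velocities are values of the Fréchet derivative
  have hdiff : ∀ i, i ≤ j → ∀ b ∈ S i, DifferentiableAt ℝ (fun X : PBond (F.P K) 0 → lieSU (Fin N) =>
      ((avgFamily (avOfRecord F N K) (expChart U X) i b : SU N) : Matrix (Fin N) (Fin N) ℂ)) 0 :=
    fun i hi b hb => (contDiffAt_coe_avgFamily_expChart_of_small_on_closedBelow (n := 1) hk S hS hg i (hi.trans hj) b hb).differentiableAt one_ne_zero
  set Λf : Finset (PBond (F.P K) j) := (Set.toFinite (bondsOf (𝔹 j))).toFinset with hΛf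
  have hmem : ∀ c, c ∈ Λf ↔ c ∈ bondsOf (𝔹 j) := fun c => Set.Finite.mem_toFinset _
  have hD : ∀ i, i ≤ j → ∀ b ∈ S i,
      HasDerivAt (fun t : ℝ => ((avgFamily (avOfRecord F N K) (expChart U (t • ∑ c ∈ Λf, Xc c)) i b : SU N) : Matrix (Fin N) (Fin N) ℂ))
        (∑ c ∈ Λf, fderiv ℝ (fun X : PBond (F.P K) 0 → lieSU (Fin N) =>
          ((avgFamily (avOfRecord F N K) (expChart U X) i b : SU N) : Matrix (Fin N) (Fin N) ℂ)) 0 (Xc c)) 0 := by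
    intro i hi b hb
    have h := hasDerivAt_ray_of_differentiableAt (hdiff i hi b hb) (∑ c ∈ Λf, Xc c)
    rwa [map_sum] at h
  refine ⟨∑ c ∈ Λf, Xc c, fun c₀ hc₀ => ?_, fun i hi c' hc' => ?_⟩
  · -- the pin `c₀` of level `j`: only its own single lift contributes
    have hc₀S : c₀ ∈ S j := h𝔹S j hj hc₀
    have h := hD j le_rfl c₀ hc₀S
    rw [Finset.sum_eq_single c₀ (fun c hc hne => (hasDerivAt_ray_of_differentiableAt (hdiff j le_rfl c₀ hc₀S) (Xc c)).unique
      ((hXc c ((hmem c).1 hc)).2.1 c₀ hc₀S hne.symm)) (fun h0 => absurd ((hmem c₀).2 hc₀) h0)] at h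
    have hu : fderiv ℝ (fun X : PBond (F.P K) 0 → lieSU (Fin N) =>
        ((avgFamily (avOfRecord F N K) (expChart U X) j c₀ : SU N) : Matrix (Fin N) (Fin N) ℂ)) 0 (Xc c₀) =
        ((avgFamily (avOfRecord F N K) U j c₀ : SU N) : Matrix (Fin N) (Fin N) ℂ) * ((σ c₀ : lieSU (Fin N)) : Matrix (Fin N) (Fin N) ℂ) :=
      (hasDerivAt_ray_of_differentiableAt (hdiff j le_rfl c₀ hc₀S) (Xc c₀)).unique (hXc c₀ hc₀).1
    rw [hu, hU j c₀ hc₀] at h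
    exact h
  · -- a pin `c'` of a lower level `i < j`: it is off the tower `T i`, so every single lift is invisible there
    have hc'S : c' ∈ S i := h𝔹S i (hi.le.trans hj) hc'
    have hc'T : c' ∉ T i := Set.disjoint_right.1 (hdisj i hi) hc'
    have h := hD i hi.le c' hc'S
    rw [Finset.sum_eq_zero (fun c hc => (hasDerivAt_ray_of_differentiableAt (hdiff i hi.le c' hc'S) (Xc c)).unique
      ((hXc c ((hmem c).1 hc)).2.2 i hi c' hc'S hc'T))] at h
    exact h

/-- ★★ **(45) AT `U` FROM CENTRAL RESPONSES** (`exists_velocity_preimage_of_levelLifts` fed by the lifts above): every multi-level target family on the pins is the velocity family of ONE direction.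
[cite: Balaban1985Variational, (45) p.285, (83) p.290; Balaban1984PropagatorsII, p.228] -/
theorem exists_velocity_preimage_of_centralResponses (hk : k ≤ (F.P K).m + (F.P K).K) (hU : AgreeOn 𝔹 (avgFamily (avOfRecord F N K) U) W)
    (S : (i : ℕ) → Set (PBond (F.P K) i))
    (hS : ∀ (i : ℕ) (c : PBond (F.P K) (i + 1)), i + 1 ≤ k → c ∈ S (i + 1) → ∀ b : PBond (F.P K) i, (blockOf b.src = c.src ∨ blockOf b.src = c.tgt) → b ∈ S i)
    (hg : ∀ (i : ℕ) (c : PBond (F.P K) (i + 1)), i + 1 ≤ k → c ∈ S (i + 1) → Small (expMeanLogSU (n := Fin N)) (avgFamily (avOfRecord F N K) U i) c)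
    (h𝔹S : ∀ j, j ≤ k → bondsOf (𝔹 j) ⊆ S j)
    (hCF : ∀ ℓ, ℓ ≤ k → ∃ T : (i : ℕ) → Set (PBond (F.P K) i), bondsOf (𝔹 ℓ) ⊆ T ℓ ∧ (∀ i, i < ℓ → ∀ c : PBond (F.P K) (i + 1), c ∈ T (i + 1) → centralBond c ∈ T i) ∧ ∀ j, j < ℓ → Disjoint (T j) (bondsOf (𝔹 j)))
    (hresp : ∀ (i : ℕ) (c : PBond (F.P K) (i + 1)), i + 1 ≤ k → c ∈ S (i + 1) → ∀ Y' : lieSU (Fin N), ∃ Y : lieSU (Fin N),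
      fderiv ℝ (fun W : PBond (F.P K) i → Matrix (Fin N) (Fin N) ℂ => avgM W c) (coeField (avgFamily (avOfRecord F N K) U i))
          (Pi.single (centralBond c) (((avgFamily (avOfRecord F N K) U i (centralBond c) : SU N) : Matrix (Fin N) (Fin N) ℂ) * (Y : Matrix (Fin N) (Fin N) ℂ))) =
        ((avgFamily (avOfRecord F N K) U (i + 1) c : SU N) : Matrix (Fin N) (Fin N) ℂ) * (Y' : Matrix (Fin N) (Fin N) ℂ))
    (τ : (j : ℕ) → PBond (F.P K) j → lieSU (Fin N)) :
    ∃ X : PBond (F.P K) 0 → lieSU (Fin N), ∀ j, j ≤ k → ∀ c ∈ bondsOf (𝔹 j),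
      HasDerivAt (fun t : ℝ => ((avgFamily (avOfRecord F N K) (expChart U (t • X)) j c : SU N) : Matrix (Fin N) (Fin N) ℂ))
        (((W j c : SU N) : Matrix (Fin N) (Fin N) ℂ) * ((τ j c : lieSU (Fin N)) : Matrix (Fin N) (Fin N) ℂ)) 0 :=
  exists_velocity_preimage_of_levelLifts_of_small_on_closedBelow hk hU S hS hg h𝔹S (levelLifts_of_centralResponses hk hU S hS hg h𝔹S hCF hresp) τ

/-- ★★ **35a's `IsFibreChartNear` FOR THE CANONICAL MULTI-SCALE CHART FROM CENTRAL RESPONSES** (guard on a closed-below family, chain-free towers, one-step central responses).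
[cite: Balaban1985Variational, (45)–(48) p.285, Prop. 3 p.289, (82)–(83) p.290; Balaban1988Convergent, (2.10)–(2.12) p.256] -/
theorem isFibreChartNear_msChart_of_centralResponses (h𝔹 : ∀ j, k < j → 𝔹 j = ∅) (hk : k ≤ (F.P K).m + (F.P K).K)
    (hU : AgreeOn 𝔹 (avgFamily (avOfRecord F N K) U) W)
    (S : (i : ℕ) → Set (PBond (F.P K) i))
    (hS : ∀ (i : ℕ) (c : PBond (F.P K) (i + 1)), i + 1 ≤ k → c ∈ S (i + 1) → ∀ b : PBond (F.P K) i, (blockOf b.src = c.src ∨ blockOf b.src = c.tgt) → b ∈ S i)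
    (hg : ∀ (i : ℕ) (c : PBond (F.P K) (i + 1)), i + 1 ≤ k → c ∈ S (i + 1) → Small (expMeanLogSU (n := Fin N)) (avgFamily (avOfRecord F N K) U i) c)
    (h𝔹S : ∀ j, j ≤ k → bondsOf (𝔹 j) ⊆ S j)
    (hCF : ∀ ℓ, ℓ ≤ k → ∃ T : (i : ℕ) → Set (PBond (F.P K) i), bondsOf (𝔹 ℓ) ⊆ T ℓ ∧ (∀ i, i < ℓ → ∀ c : PBond (F.P K) (i + 1), c ∈ T (i + 1) → centralBond c ∈ T i) ∧ ∀ j, j < ℓ → Disjoint (T j) (bondsOf (𝔹 j)))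
    (hresp : ∀ (i : ℕ) (c : PBond (F.P K) (i + 1)), i + 1 ≤ k → c ∈ S (i + 1) → ∀ Y' : lieSU (Fin N), ∃ Y : lieSU (Fin N),
      fderiv ℝ (fun W : PBond (F.P K) i → Matrix (Fin N) (Fin N) ℂ => avgM W c) (coeField (avgFamily (avOfRecord F N K) U i))
          (Pi.single (centralBond c) (((avgFamily (avOfRecord F N K) U i (centralBond c) : SU N) : Matrix (Fin N) (Fin N) ℂ) * (Y : Matrix (Fin N) (Fin N) ℂ))) =
        ((avgFamily (avOfRecord F N K) U (i + 1) c : SU N) : Matrix (Fin N) (Fin N) ℂ) * (Y' : Matrix (Fin N) (Fin N) ℂ)) :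
    IsFibreChartNear F N K 𝔹 W U (msChart F N K k 𝔹 W U) (fderiv ℝ (msChart F N K k 𝔹 W U) 0) :=
  isFibreChartNear_msChart_of_levelLifts_of_small_on_closedBelow h𝔹 hk hU S hS hg h𝔹S (levelLifts_of_centralResponses hk hU S hS hg h𝔹S hCF hresp)

/-- ★★★ **CURVE-CRITICAL ⇒ TANGENT-CRITICAL ON A MULTI-SCALE FIBRE FROM ONE-STEP CENTRAL RESPONSES** — the chart road to print's (82) on (83) with every multi-scale ingredient supplied: the
local smoothness from the guard on `S` (file 1), the right inverse (45) from the chain-free towers and the central responses (this file); displayed: the guard, `hCF`, and the per-bond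
surjectivity `hresp` of the linearised one-block average in its private coordinate. [cite: Balaban1985Variational, (82)–(83) p.290, (141) p.299, Prop. 8 p.304, (45) p.285; Balaban1988Convergent, (2.10)–(2.12) p.256] -/
theorem hasDerivAt_wilsonAction4_expChart_of_isCritOnFibre_of_centralResponses (h𝔹 : ∀ j, k < j → 𝔹 j = ∅)
    (hk : k ≤ (F.P K).m + (F.P K).K) (hU : AgreeOn 𝔹 (avgFamily (avOfRecord F N K) U) W)
    (S : (i : ℕ) → Set (PBond (F.P K) i))
    (hS : ∀ (i : ℕ) (c : PBond (F.P K) (i + 1)), i + 1 ≤ k → c ∈ S (i + 1) → ∀ b : PBond (F.P K) i, (blockOf b.src = c.src ∨ blockOf b.src = c.tgt) → b ∈ S i)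
    (hg : ∀ (i : ℕ) (c : PBond (F.P K) (i + 1)), i + 1 ≤ k → c ∈ S (i + 1) → Small (expMeanLogSU (n := Fin N)) (avgFamily (avOfRecord F N K) U i) c)
    (h𝔹S : ∀ j, j ≤ k → bondsOf (𝔹 j) ⊆ S j)
    (hCF : ∀ ℓ, ℓ ≤ k → ∃ T : (i : ℕ) → Set (PBond (F.P K) i), bondsOf (𝔹 ℓ) ⊆ T ℓ ∧ (∀ i, i < ℓ → ∀ c : PBond (F.P K) (i + 1), c ∈ T (i + 1) → centralBond c ∈ T i) ∧ ∀ j, j < ℓ → Disjoint (T j) (bondsOf (𝔹 j)))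
    (hresp : ∀ (i : ℕ) (c : PBond (F.P K) (i + 1)), i + 1 ≤ k → c ∈ S (i + 1) → ∀ Y' : lieSU (Fin N), ∃ Y : lieSU (Fin N),
      fderiv ℝ (fun W : PBond (F.P K) i → Matrix (Fin N) (Fin N) ℂ => avgM W c) (coeField (avgFamily (avOfRecord F N K) U i))
          (Pi.single (centralBond c) (((avgFamily (avOfRecord F N K) U i (centralBond c) : SU N) : Matrix (Fin N) (Fin N) ℂ) * (Y : Matrix (Fin N) (Fin N) ℂ))) =
        ((avgFamily (avOfRecord F N K) U (i + 1) c : SU N) : Matrix (Fin N) (Fin N) ℂ) * (Y' : Matrix (Fin N) (Fin N) ℂ))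
    (hcrit : IsCritOnFibre F N K 𝔹 W U) {X : PBond (F.P K) 0 → lieSU (Fin N)}
    (hX : ∀ j, j ≤ k → ∀ c ∈ bondsOf (𝔹 j),
      HasDerivAt (fun t : ℝ => ((avgFamily (avOfRecord F N K) (expChart U (t • X)) j c : SU N) : Matrix (Fin N) (Fin N) ℂ)) 0 0) :
    HasDerivAt (fun t : ℝ => wilsonAction4 (expChart U (t • X))) 0 0 :=
  hasDerivAt_wilsonAction4_expChart_of_isCritOnFibre_of_levelLifts_of_small_on_closedBelow h𝔹 hk hU S hS hg h𝔹S
    (levelLifts_of_centralResponses hk hU S hS hg h𝔹S hCF hresp) hcrit hX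

end Assembly

end Summit.QuantumFields.YangMills.BalabanUVNodes.N07CentralDescendantLifts

end
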